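/-
Copyright (c) 2026 the pub-hodgecm-mathlib formalisation cell (harness21).  Prover seat hodgecm-mathlib-F0P2-p02 (g21); dealer LH4-plan (g7) WORD #27 (l) (C0a),
2026-09-02.  Count-neutral base layer of the dyadic (D-UNR) column (LAYER C prerequisite (C0a) of CENSUS-C5 bd72510a §6).
-/
import Literature.NumberTheory.Automorphic.UnitaryThreeDoubleCosetsHKTrace       -- ★ p851802 (LH4-p03 g8) LAYER B 1∕3: `u_m^{(y,z)}`, cover `…_of_rel`, disjointness `…_of_rel`, trace instance `(1, −b)`
import Literature.NumberTheory.Automorphic.FixedPointsDoubleCosetUnfolding        -- ★ (F2a): the abstract unfolding of fixed points over a double-coset decomposition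
import HarnessLib

/-!
# Flicker's Proposition 5 for `U(2,1)` WITHOUT `|2| = 1`: the `t`-fixed points of `U ⧸ K₀` unfold over the double cosets `H u_m^{(y,z)} K₀`
(Flicker (1998), *Elementary proof of the fundamental lemma for a unitary group*, Prop. 5 p. 82 — every residue characteristic)

Topic `NumberTheory/Automorphic`; namespace `Literature.NumberTheory.Automorphic.UnitaryGroup`.  KERNEL mathematics only: theorems, no definition, no
named fact, no instance, no notation, no `sorry`.  Cell `pub/hodgecm-mathlib`, crux H413 = `stmt-HodgeConjecture-24833` (lane `--supports`); LH4 board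
(D-UNR), prerequisite (C0a) of LAYER C (CENSUS-C5 `F0/P3c/LH3/LH3-p02/g6/c5/CENSUS-C5-InertCountsValuesTrace.v1.md` §4∕§6, LH3-p02 (g6); dealer LH4-plan (g7)
WORD #27 (l)): the 2-FREE TWIN of ★ `UnitOrbitalIntegralUnfoldingHK` (Flicker frame `u_m`, `y·σy = −2`, `|2| = 1` through ★ `LocalConjDatum`) over ★
`UnramifiedLocalConjDatum σ ϖ` and the two-parameter level elements of ★ `UnitaryThreeDoubleCosetsHKTrace` (p851802)

  `u_m^{(y,z)} = !![ϖ^m, y, z·ϖ^{−m}; 0, 1, −σy·ϖ^{−m}; 0, 0, ϖ^{−m}]`,  `z + σz + y·σy = 0`, `|y| = 1`, `|z| ≤ 1`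

(trace-frame instance `(y, z) = (1, −b)`, `b + σb = 1`, ★ `exists_coe_eq_flickerU_trace`).  WHAT CHANGES w.r.t. ★: only the two (F1) inputs — the cover is ★
`exists_mem_centralizer_mul_flickerU_mul_mem_unitaryInt_of_rel` (`hy hzv hz`, no `½`) and the disjointness is ★ `eq_of_centralizer_mul_flickerU_mul_unitaryInt_eq_of_rel`
(`hy` + the CHARACTERISTIC token `h2 : (2 : K) ≠ 0` for the block shape of `H = Z(diag(1,−1,1))`, not `|2| = 1`); the abstract unfolding ★ (F2a)
`FixedPointsDoubleCosetUnfolding` is cited by name, unchanged.  Binder block `{y z} (hy) (hzv) (hz) … (u) (hu)` = ★ C4-1 p851921's, with `u : ℕ → U` a BINDER given with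
its matrices (`hu`); §2 supplies such a `u` for any admissible `(y, z)` and for the trace instance.

STATEMENT (§1).  `U = U(σ, Φ₃)(K)`, `K₀ = unitaryInt σ Φ₃`, `H = Z_U(c)`, `c = diag(1,−1,1)`, `H^K_m = H ∩ u_m K₀ u_m⁻¹` (as the subgroup
`((unitaryInt σ J).map (MulAut.conj (u m))).subgroupOf H`, congruences ★ `flickerU_of_rel_inv_mul_mul_mem_unitaryInt_iff` p851832).  For `t ∈ H` with finitely many
fixed points on `U ⧸ K₀`: **`#{q ∈ U ⧸ K₀ : t • q = q} = Σᶠ_{m ≥ 0} #{hH^K_m : t • hH^K_m = hH^K_m}`** (`natCard_fixedPoints_unitaryInt_eq_finsum_flickerU_of_rel`), the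
bijection behind it (`exists_equiv_fixedPoints_sigma_flickerU_of_rel`), and the finiteness of the index set and of every summand
(`finite_setOf_nonempty_fixedPoints_flickerU_of_rel` — the `hfin`-side input of ★ C4-1 `natCard_fixedPoints_centralizer_eq_finsum_of_rel`); the summand's condition
`t • hH^K_m = hH^K_m ↔ (h u_m)⁻¹ t (h u_m) ∈ K₀` is ★ `smul_mk_eq_iff_flickerU` (any `u`, cited not restated).
HONEST LABEL: HC_CM is proved only modulo the printed citations (2 remaining named inputs hLiu418 = `stmt-HodgeConjecture-24832`, h413 = `stmt-HodgeConjecture-24833`)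
until rung 0 closes; structure theory, pays no organ, opens no road ((D-UNR) stays PRINT by D74′).

References: [Flicker1998UnitaryFL] Y. Z. Flicker, Canad. J. Math. 50 (1998), Prop. 4 pp. 80–81, Prop. 5 p. 82 · [Rogawski1990] J. D. Rogawski, Ann. of Math. Stud. 123,
§4.9 p. 54 · [Serre1979] J.-P. Serre, *Local Fields*, Ch. V §2 Prop. 3 (the trace-one integer `b`). -/

set_option autoImplicit false

open scoped MatrixGroups WithZero

namespace Literature.NumberTheory.Automorphic

namespace UnitaryGroup

open Literature.NumberTheory.Automorphic.HermitianLattice (unitaryInt UnramifiedLocalConjDatum)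
open Literature.NumberTheory.Automorphic.DoubleCosetFixedPoints

variable {K : Type*} [Field K] [Valued K ℤᵐ⁰] {ϖ : K}
  (σ : K →+* K) {J : Matrix (Fin 3) (Fin 3) K} (hJ : J = (StdForm.antidiagonal 3).over K)

/-! ## §1 Prop. 5 over the 2-free level elements `u_m^{(y,z)}` -/

include hJ in
/-- (F1) 2-free, in the abstract shape `hA`∕`hB` of ★ (F2a): with the level elements `u_m^{(y,z)}` (given with their matrices), every `g ∈ U` is `h u_m k`
(`h ∈ H = Z_U(c)`, `k ∈ K₀`; ★ `…_of_rel` cover, `|y| = 1`, `|z| ≤ 1`, no `½`) and the index `m` of the double coset `H g K₀` is unique (★ `…_of_rel` disjointness,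
`(2 : K) ≠ 0`).  Twin of ★ `flickerU_doubleCoset_cover_and_disjoint`. [cite: Flicker1998UnitaryFL, Prop. 4 pp. 80–81] -/
theorem flickerU_doubleCoset_cover_and_disjoint_of_rel (hd : UnramifiedLocalConjDatum σ ϖ) (h2 : (2 : K) ≠ 0)
    {y z : K} (hy : Valued.v y = 1) (hzv : Valued.v z ≤ 1) (hz : z + σ z + y * σ y = 0)
    {c : ↥(unitaryGroupOfForm σ J)} (hc : ((c : GL (Fin 3) K) : Matrix (Fin 3) (Fin 3) K) = !![1, 0, 0; 0, -1, 0; 0, 0, 1])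
    (u : ℕ → ↥(unitaryGroupOfForm σ J))
    (hu : ∀ m, ((u m : GL (Fin 3) K) : Matrix (Fin 3) (Fin 3) K) = !![ϖ ^ m, y, z * (ϖ ^ m)⁻¹; 0, 1, -σ y * (ϖ ^ m)⁻¹; 0, 0, (ϖ ^ m)⁻¹]) :
    (∀ g : ↥(unitaryGroupOfForm σ J), ∃ m, ∃ h ∈ Subgroup.centralizer ({c} : Set ↥(unitaryGroupOfForm σ J)), ∃ k ∈ unitaryInt σ J,
        g = h * u m * k) ∧
      ∀ m n, ∀ h ∈ Subgroup.centralizer ({c} : Set ↥(unitaryGroupOfForm σ J)), ∀ h' ∈ Subgroup.centralizer ({c} : Set ↥(unitaryGroupOfForm σ J)),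
        ∀ k ∈ unitaryInt σ J, ∀ k' ∈ unitaryInt σ J, h * u m * k = h' * u n * k' → m = n := by
  refine ⟨fun g => ?_, fun m n h hh h' hh' k hk k' hk' heq => ?_⟩
  · obtain ⟨m, h, u', k, hh, hu', hk, hg⟩ := exists_mem_centralizer_mul_flickerU_mul_mem_unitaryInt_of_rel σ hJ hd hy hzv hz hc g
    have huu : u' = u m := Subtype.ext (Matrix.GeneralLinearGroup.ext fun i j => by rw [hu', hu m])
    exact ⟨m, h, hh, k, hk, by rw [hg, huu]⟩
  · exact eq_of_centralizer_mul_flickerU_mul_unitaryInt_eq_of_rel σ hJ hd h2 hy hc hh (hu m) hk hh' (hu n) hk' heq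

set_option synthInstance.maxHeartbeats 200000 in
-- the `H`-action on `H ⧸ H^K_m` is found through the large subgroup terms of the `U(2,1)` frame
include hJ in
/-- **FLICKER'S PROPOSITION 5 (bijection form) for `U(2,1)`, every residue characteristic**: for `t ∈ H = Z_U(diag(1,−1,1))`, the `t`-fixed points of `U ⧸ K₀` are in
bijection with `Σ_m {hH^K_m ∈ H ⧸ H^K_m : t • hH^K_m = hH^K_m}`, `H^K_m = H ∩ u_m^{(y,z)} K₀ (u_m^{(y,z)})⁻¹` (`(m, hH^K_m) ↦ h u_m^{(y,z)} K₀`).  Twin of ★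
`exists_equiv_fixedPoints_sigma_flickerU`. [cite: Flicker1998UnitaryFL, Prop. 5 p. 82] -/
theorem exists_equiv_fixedPoints_sigma_flickerU_of_rel (hd : UnramifiedLocalConjDatum σ ϖ) (h2 : (2 : K) ≠ 0)
    {y z : K} (hy : Valued.v y = 1) (hzv : Valued.v z ≤ 1) (hz : z + σ z + y * σ y = 0)
    {c : ↥(unitaryGroupOfForm σ J)} (hc : ((c : GL (Fin 3) K) : Matrix (Fin 3) (Fin 3) K) = !![1, 0, 0; 0, -1, 0; 0, 0, 1])
    (u : ℕ → ↥(unitaryGroupOfForm σ J))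
    (hu : ∀ m, ((u m : GL (Fin 3) K) : Matrix (Fin 3) (Fin 3) K) = !![ϖ ^ m, y, z * (ϖ ^ m)⁻¹; 0, 1, -σ y * (ϖ ^ m)⁻¹; 0, 0, (ϖ ^ m)⁻¹])
    {t : ↥(unitaryGroupOfForm σ J)} (ht : t ∈ Subgroup.centralizer ({c} : Set ↥(unitaryGroupOfForm σ J))) :
    Nonempty ({q : ↥(unitaryGroupOfForm σ J) ⧸ unitaryInt σ J // t • q = q} ≃
      Σ m : ℕ, {w : ↥(Subgroup.centralizer ({c} : Set ↥(unitaryGroupOfForm σ J))) ⧸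
          ((unitaryInt σ J).map (MulAut.conj (u m)).toMonoidHom).subgroupOf (Subgroup.centralizer ({c} : Set ↥(unitaryGroupOfForm σ J))) //
        (⟨t, ht⟩ : ↥(Subgroup.centralizer ({c} : Set ↥(unitaryGroupOfForm σ J)))) • w = w}) := by
  obtain ⟨hA, hB⟩ := flickerU_doubleCoset_cover_and_disjoint_of_rel σ hJ hd h2 hy hzv hz hc u hu
  exact exists_equiv_fixedPoints_sigma _ _ u hA hB ht

set_option synthInstance.maxHeartbeats 200000 in
-- the `H`-action on `H ⧸ H^K_m` is found through the large subgroup terms of the `U(2,1)` frame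
include hJ in
/-- **FLICKER'S PROPOSITION 5 (counted) for `U(2,1)`, every residue characteristic**: for `t ∈ H` with finitely many fixed points on `U ⧸ K₀`,
**`#{q ∈ U ⧸ K₀ : t • q = q} = Σᶠ_{m ≥ 0} #{hH^K_m : t • hH^K_m = hH^K_m}`** over the level elements `u_m^{(y,z)}` — «`∫_{G∕K} 1_K(x⁻¹tx) dx = Σ_{m ≥ 0} ∫_{H∕H^K_m}
1_{H^K_m}(h⁻¹th) dh`» with counting measures; the summand's condition reads `(h u_m)⁻¹ t (h u_m) ∈ K₀` (★ `smul_mk_eq_iff_flickerU`), i.e. the 2-free congruences of ★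
`flickerU_of_rel_inv_mul_mul_mem_unitaryInt_iff`.  Twin of ★ `natCard_fixedPoints_unitaryInt_eq_finsum_flickerU`. [cite: Flicker1998UnitaryFL, Prop. 5 p. 82] -/
theorem natCard_fixedPoints_unitaryInt_eq_finsum_flickerU_of_rel (hd : UnramifiedLocalConjDatum σ ϖ) (h2 : (2 : K) ≠ 0)
    {y z : K} (hy : Valued.v y = 1) (hzv : Valued.v z ≤ 1) (hz : z + σ z + y * σ y = 0)
    {c : ↥(unitaryGroupOfForm σ J)} (hc : ((c : GL (Fin 3) K) : Matrix (Fin 3) (Fin 3) K) = !![1, 0, 0; 0, -1, 0; 0, 0, 1])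
    (u : ℕ → ↥(unitaryGroupOfForm σ J))
    (hu : ∀ m, ((u m : GL (Fin 3) K) : Matrix (Fin 3) (Fin 3) K) = !![ϖ ^ m, y, z * (ϖ ^ m)⁻¹; 0, 1, -σ y * (ϖ ^ m)⁻¹; 0, 0, (ϖ ^ m)⁻¹])
    {t : ↥(unitaryGroupOfForm σ J)} (ht : t ∈ Subgroup.centralizer ({c} : Set ↥(unitaryGroupOfForm σ J)))
    (hfin : {q : ↥(unitaryGroupOfForm σ J) ⧸ unitaryInt σ J | t • q = q}.Finite) :
    Nat.card {q : ↥(unitaryGroupOfForm σ J) ⧸ unitaryInt σ J | t • q = q} =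
      ∑ᶠ m : ℕ, Nat.card {w : ↥(Subgroup.centralizer ({c} : Set ↥(unitaryGroupOfForm σ J))) ⧸
          ((unitaryInt σ J).map (MulAut.conj (u m)).toMonoidHom).subgroupOf (Subgroup.centralizer ({c} : Set ↥(unitaryGroupOfForm σ J))) |
        (⟨t, ht⟩ : ↥(Subgroup.centralizer ({c} : Set ↥(unitaryGroupOfForm σ J)))) • w = w} := by
  obtain ⟨hA, hB⟩ := flickerU_doubleCoset_cover_and_disjoint_of_rel σ hJ hd h2 hy hzv hz hc u hu
  exact natCard_fixedPoints_eq_finsum _ _ u hA hB ht hfin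

set_option synthInstance.maxHeartbeats 200000 in
-- the `H`-action on `H ⧸ H^K_m` is found through the large subgroup terms of the `U(2,1)` frame
include hJ in
/-- Only finitely many double cosets `H u_m^{(y,z)} K₀` carry a `t`-fixed point, and each carries finitely many (so the `Σᶠ` above is an honest finite sum; this is the
`hfin` input of ★ C4-1 `natCard_fixedPoints_centralizer_eq_finsum_of_rel` summand by summand).  Twin of ★ `finite_setOf_nonempty_fixedPoints_flickerU`.
[cite: Flicker1998UnitaryFL, Prop. 5 p. 82] -/
theorem finite_setOf_nonempty_fixedPoints_flickerU_of_rel (hd : UnramifiedLocalConjDatum σ ϖ) (h2 : (2 : K) ≠ 0)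
    {y z : K} (hy : Valued.v y = 1) (hzv : Valued.v z ≤ 1) (hz : z + σ z + y * σ y = 0)
    {c : ↥(unitaryGroupOfForm σ J)} (hc : ((c : GL (Fin 3) K) : Matrix (Fin 3) (Fin 3) K) = !![1, 0, 0; 0, -1, 0; 0, 0, 1])
    (u : ℕ → ↥(unitaryGroupOfForm σ J))
    (hu : ∀ m, ((u m : GL (Fin 3) K) : Matrix (Fin 3) (Fin 3) K) = !![ϖ ^ m, y, z * (ϖ ^ m)⁻¹; 0, 1, -σ y * (ϖ ^ m)⁻¹; 0, 0, (ϖ ^ m)⁻¹])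
    {t : ↥(unitaryGroupOfForm σ J)} (ht : t ∈ Subgroup.centralizer ({c} : Set ↥(unitaryGroupOfForm σ J)))
    (hfin : {q : ↥(unitaryGroupOfForm σ J) ⧸ unitaryInt σ J | t • q = q}.Finite) :
    {m : ℕ | Nonempty {w : ↥(Subgroup.centralizer ({c} : Set ↥(unitaryGroupOfForm σ J))) ⧸
          ((unitaryInt σ J).map (MulAut.conj (u m)).toMonoidHom).subgroupOf (Subgroup.centralizer ({c} : Set ↥(unitaryGroupOfForm σ J))) //
        (⟨t, ht⟩ : ↥(Subgroup.centralizer ({c} : Set ↥(unitaryGroupOfForm σ J)))) • w = w}}.Finite ∧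
      ∀ m : ℕ, Finite {w : ↥(Subgroup.centralizer ({c} : Set ↥(unitaryGroupOfForm σ J))) ⧸
          ((unitaryInt σ J).map (MulAut.conj (u m)).toMonoidHom).subgroupOf (Subgroup.centralizer ({c} : Set ↥(unitaryGroupOfForm σ J))) //
        (⟨t, ht⟩ : ↥(Subgroup.centralizer ({c} : Set ↥(unitaryGroupOfForm σ J)))) • w = w} := by
  obtain ⟨hA, hB⟩ := flickerU_doubleCoset_cover_and_disjoint_of_rel σ hJ hd h2 hy hzv hz hc u hu
  exact finite_setOf_nonempty_fixedPoints _ _ u hA hB ht hfin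

/-! ## §2 The level elements as a sequence `u : ℕ → U` (the binder `(u) (hu)` of §1 is inhabited) -/

include hJ in
/-- **A sequence of level elements `m ↦ u_m^{(y,z)} ∈ U` exists** for every pair with the unipotent relation `z + σz + y·σy = 0` (★ `exists_coe_eq_flickerU_of_rel`,
one `m` at a time, assembled by choice) — the binder `(u) (hu)` of §1. [cite: Flicker1998UnitaryFL, Prop. 4 p. 80] -/
theorem exists_seq_coe_eq_flickerU_of_rel (hd : UnramifiedLocalConjDatum σ ϖ) {y z : K} (hz : z + σ z + y * σ y = 0) :
    ∃ u : ℕ → ↥(unitaryGroupOfForm σ J),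
      ∀ m, ((u m : GL (Fin 3) K) : Matrix (Fin 3) (Fin 3) K) = !![ϖ ^ m, y, z * (ϖ ^ m)⁻¹; 0, 1, -σ y * (ϖ ^ m)⁻¹; 0, 0, (ϖ ^ m)⁻¹] :=
  ⟨fun m => (exists_coe_eq_flickerU_of_rel σ hJ hd hz m).choose, fun m => (exists_coe_eq_flickerU_of_rel σ hJ hd hz m).choose_spec⟩

include hJ in
/-- **The trace-frame sequence `m ↦ u_m^{(1,−b)} ∈ U`** for `b + σb = 1` (★ `exists_coe_eq_flickerU_trace`; the `Q_b`-currency of ★ `Rogawski1990/FlickerTorusTraceFrame`),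
available at every unramified place from ★ `UnramifiedLocalConjDatum.trace`. [cite: Flicker1998UnitaryFL, Prop. 4 p. 80] [cite: Serre1979, Ch. V §2 Prop. 3] -/
theorem exists_seq_coe_eq_flickerU_trace (hd : UnramifiedLocalConjDatum σ ϖ) {b : K} (hb : b + σ b = 1) :
    ∃ u : ℕ → ↥(unitaryGroupOfForm σ J),
      ∀ m, ((u m : GL (Fin 3) K) : Matrix (Fin 3) (Fin 3) K) = !![ϖ ^ m, 1, -b * (ϖ ^ m)⁻¹; 0, 1, -(ϖ ^ m)⁻¹; 0, 0, (ϖ ^ m)⁻¹] :=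
  ⟨fun m => (exists_coe_eq_flickerU_trace σ hJ hd hb m).choose, fun m => (exists_coe_eq_flickerU_trace σ hJ hd hb m).choose_spec⟩

set_option synthInstance.maxHeartbeats 200000 in
-- the `H`-action on `H ⧸ H^K_m` is found through the large subgroup terms of the `U(2,1)` frame
include hJ in
/-- **Prop. 5 (counted) in the TRACE FRAME** `(y, z) = (1, −b)`, `b + σb = 1`, `|b| ≤ 1` — the instance every unramified place affords (no `y` with `y·σy = −2` is
needed): §1 with `hy := |1| = 1`, `hz` from `1 − (b + σb) = 0`. [cite: Flicker1998UnitaryFL, Prop. 5 p. 82] [cite: Serre1979, Ch. V §2 Prop. 3] -/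
theorem natCard_fixedPoints_unitaryInt_eq_finsum_flickerU_trace (hd : UnramifiedLocalConjDatum σ ϖ) (h2 : (2 : K) ≠ 0)
    {b : K} (hbv : Valued.v b ≤ 1) (hb : b + σ b = 1)
    {c : ↥(unitaryGroupOfForm σ J)} (hc : ((c : GL (Fin 3) K) : Matrix (Fin 3) (Fin 3) K) = !![1, 0, 0; 0, -1, 0; 0, 0, 1])
    (u : ℕ → ↥(unitaryGroupOfForm σ J))
    (hu : ∀ m, ((u m : GL (Fin 3) K) : Matrix (Fin 3) (Fin 3) K) = !![ϖ ^ m, 1, -b * (ϖ ^ m)⁻¹; 0, 1, -(ϖ ^ m)⁻¹; 0, 0, (ϖ ^ m)⁻¹])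
    {t : ↥(unitaryGroupOfForm σ J)} (ht : t ∈ Subgroup.centralizer ({c} : Set ↥(unitaryGroupOfForm σ J)))
    (hfin : {q : ↥(unitaryGroupOfForm σ J) ⧸ unitaryInt σ J | t • q = q}.Finite) :
    Nat.card {q : ↥(unitaryGroupOfForm σ J) ⧸ unitaryInt σ J | t • q = q} =
      ∑ᶠ m : ℕ, Nat.card {w : ↥(Subgroup.centralizer ({c} : Set ↥(unitaryGroupOfForm σ J))) ⧸
          ((unitaryInt σ J).map (MulAut.conj (u m)).toMonoidHom).subgroupOf (Subgroup.centralizer ({c} : Set ↥(unitaryGroupOfForm σ J))) |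
        (⟨t, ht⟩ : ↥(Subgroup.centralizer ({c} : Set ↥(unitaryGroupOfForm σ J)))) • w = w} := by
  have hy : Valued.v (1 : K) = 1 := map_one _
  have hzv : Valued.v (-b) ≤ 1 := by rw [Valuation.map_neg]; exact hbv
  have hz : (-b) + σ (-b) + 1 * σ 1 = 0 := by rw [map_neg, map_one]; linear_combination -hb
  have hu' : ∀ m, ((u m : GL (Fin 3) K) : Matrix (Fin 3) (Fin 3) K) =
      !![ϖ ^ m, (1 : K), (-b) * (ϖ ^ m)⁻¹; 0, 1, -σ 1 * (ϖ ^ m)⁻¹; 0, 0, (ϖ ^ m)⁻¹] := fun m => by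
    rw [hu m, map_one, neg_mul, neg_mul, one_mul]
  exact natCard_fixedPoints_unitaryInt_eq_finsum_flickerU_of_rel σ hJ hd h2 hy hzv hz hc u hu' ht hfin

end UnitaryGroup

end Literature.NumberTheory.Automorphic
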